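import Summits.ResolutionOfSingularities.ResolutionOfSingularities.Theses.CleanCovers
import Summits.ResolutionOfSingularities.ResolutionOfSingularities.Theorems.CleanCoversCoverResolutionSplit
import Summits.ResolutionOfSingularities.ResolutionOfSingularities.Theorems.CleanCoversCoverResolutionKedlayaLocalCover
import Summits.ResolutionOfSingularities.ResolutionOfSingularities.Theorems.CleanCoversCoverResolutionBinaryPatchingOverField
import Summits.ResolutionOfSingularities.ResolutionOfSingularities.Theorems.CleanCoversCoverResolutionCoverInductionOverField
import Summits.ResolutionOfSingularities.ResolutionOfSingularities.Theorems.CleanCoversKedlayaReduction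
import Literature.AlgebraicGeometry.Resolution.ProperModelsPatchingOfResolution
import Literature.AlgebraicGeometry.Resolution.LogRegularSchemeEtale
import Literature.AlgebraicGeometry.Resolution.PrincipalizationToResolution
import Literature.AlgebraicGeometry.Motives.VarietiesProperProofs
import HarnessLib

/-!
# Crux `CleanCovers.CoverResolution` (stmt-ResolutionOfSingularities-15104), line `strategy-split`
# v2: ASSEMBLY and CERTIFICATES — the crux is EQUIVALENT to
# (local resolution along the hyperplane at infinity) ∧ (Zariski two-model patching over perfect fields)

Route `ResolutionOfSingularities/CleanCovers`, line lead (continuation seat c1)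
`prover-line-stmt-ResolutionOfSingularities-15104-c1-0`, 2026-08-17. The v2 skeleton of the line
(`Cruxes/CoverResolution/Lines/strategy_split.lean`) reshapes the crux-strategist's split
(v1: P1 `BoundaryLogRegularization` → P3 `LogRegularPatching` → P2 `LogRegularResolution` →
`CoverResolution`, assembly `coverResolution_of_subs`) into two open inputs, written here VERBATIM as
binders (they are not route decls):

* **L** (`stub_boundaryLocalResolution`): for every Kedlaya cover `f : X → ℙⁿ_k` (`X` integral,
  `f` finite surjective, étale over the chart `D₊(xₙ)`, `k` perfect of characteristic `p`) and every
  point `h` off the chart there is an open `B ∋ h` of `ℙⁿ_k` with `f⁻¹(B)` resolvable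
  (`Scheme.HasResolution`).
* **T** (`stub_twoModelPatchingPerfect`): two-model patching of proper models of function fields
  over PERFECT fields of characteristic `p` (Zariski 1944 / Piltant 2013 Prop. 5.1 with
  `P = P_reg`, proper models; the tree's `ProperModel.TwoModelPatching p` sliced at perfect ground
  fields; OPEN in transcendence degree `≥ 4`).

Proved here (no `def`s, no named fact taken as a hypothesis):

* `coverResolution_of_boundaryLocalResolution_of_twoModelPatchingPerfect` (**L → T → CR**, the v2
  ASSEMBLY): the three landed stubs `stub_kedlayaLocalCover` (every point of `X` has a resolvable
  neighbourhood: étale over the regular chart, or L), `stub_binaryPatchingOverField` (Nagata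
  extension + `hasResolution_of_twoModelPatchingAt_of_cover`, with T at `k`) and
  `stub_coverInductionOverField` (finite subcover induction), applied to `X` with its
  `k`-structure `f ≫ (ℙⁿ_k → Spec k)` (separated, finite type: `f` is finite, `ℙⁿ_k` proper).
* `boundaryLocalResolution_of_coverResolution` (**CR → L**): restrict a resolution of `X` to the
  open `f⁻¹(B)` (`Scheme.HasResolution.restrict`), `B = ⊤`.
* `twoModelPatchingPerfect_of_coverResolution` (**CR → T**): `CoverResolution` at `p` gives, by the
  PROVED crux `KedlayaReduction` (`kedlayaReduction_proof`: Kedlaya 2005 Thm. 1 + projective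
  reduction, both proved in the tree), a resolution of every reduced separated finite-type scheme
  over every perfect field of characteristic `p`, in particular of the join `M₁ ⋈ M₂` of two proper
  models (`ProperModel.join`); a regular proper model dominating the join is `RegLe` over both
  (`ProperModel.exists_hom_isRegular_of_hasResolution`).
* `coverResolution_iff_boundaryLocalResolution_and_twoModelPatchingPerfect` (**CR ↔ L ∧ T**): the v2
  split loses nothing — both pieces are consequences of the crux (hence of the summit; neither is
  refutable short of `¬` resolution over a perfect field) and jointly equivalent to it.
* `boundaryLocalResolution_of_boundaryLogRegularization_of_logRegularResolution`
  (**v1 ⟹ v2 locally: P1 → P2 → L**): a proper birational log-regular (fs étale charts) model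
  `Y → f⁻¹(B)` is quasi-compact (`f⁻¹(B)` is an open of the Noetherian `X`), so P2 (Nizioł 2006
  Cor. 5.7, as a hypothesis) resolves `Y` and the resolution descends
  (`Scheme.HasResolution.of_isBirational`). Hence v1's P1 ∧ P2 give L, and with T the crux —
  v1's exotic toric patching P3 is not needed, and Nizioł's theorem only enters LOCALLY.
* `twoModelPatchingPerfect_of_twoModelPatching` (**T ⟸ the catalogued open core**
  `∀ p, ProperModel.TwoModelPatching p`): T is a slice of Zariski's patching statement, the atom
  shared with the sibling cruxes `UniversalCells.LocalToGlobal` (stmt-15232) and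
  `PatchingRelPerfect`.
-/

-- single-problem summit: the doubled namespace component `ResolutionOfSingularities` is forced
set_option linter.dupNamespace false

noncomputable section

namespace Summit.ResolutionOfSingularities.ResolutionOfSingularities.Theorems

open CategoryTheory AlgebraicGeometry TopologicalSpace
open Literature.AlgebraicGeometry.Resolution
open Summit.ResolutionOfSingularities.ResolutionOfSingularities.Theses.CleanCovers

/-! ## The v2 assembly: L → T → CoverResolution -/

/-- **ASSEMBLY (line `strategy-split` v2): local resolution along the hyperplane at infinity (L)
and Zariski two-model patching over perfect fields (T) give `CoverResolution`.** For a Kedlaya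
cover `f : X → ℙⁿ_k`: `X` is integral, separated and of finite type over `k` through
`f ≫ (ℙⁿ_k → Spec k)` and quasi-compact; every point has a resolvable open neighbourhood
(`stub_kedlayaLocalCover`: étale over the regular chart, or L); two resolvable opens of an
integral open subscheme patch (`stub_binaryPatchingOverField`, with T at the perfect field `k`);
induct over a finite subcover (`stub_coverInductionOverField`). [folklore] -/
theorem coverResolution_of_boundaryLocalResolution_of_twoModelPatchingPerfect : (∀ p : ℕ, p.Prime → ∀ (k : Type) [Field k] [CharP k p] [PerfectField k] (n : ℕ) (X : AlgebraicGeometry.Scheme.{0}) (f : X ⟶ (Literature.AlgebraicGeometry.Motives.projectiveSpace n k).left), AlgebraicGeometry.IsIntegral X → AlgebraicGeometry.IsFinite f → Function.Surjective f.base → (letI := MvPolynomial.gradedAlgebra (σ := Fin (n + 1)) (R := k); AlgebraicGeometry.Etale (f ∣_ (AlgebraicGeometry.Proj.basicOpen (MvPolynomial.homogeneousSubmodule (Fin (n + 1)) k) (MvPolynomial.X (Fin.last n))))) → ∀ h : (Literature.AlgebraicGeometry.Motives.projectiveSpace n k).left, (letI := MvPolynomial.gradedAlgebra (σ := Fin (n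 + 1)) (R := k); h ∉ AlgebraicGeometry.Proj.basicOpen (MvPolynomial.homogeneousSubmodule (Fin (n + 1)) k) (MvPolynomial.X (Fin.last n))) → ∃ B : (Literature.AlgebraicGeometry.Motives.projectiveSpace n k).left.Opens, h ∈ B ∧ Literature.AlgebraicGeometry.Resolution.Scheme.HasResolution ((f ⁻¹ᵁ B : X.Opens) : AlgebraicGeometry.Scheme.{0})) → (∀ p : ℕ, p.Prime → ∀ (k : Type) [Field k] [CharP k p] [PerfectField k] (K : Type) [Field K] [Algebra k K] [Algebra.EssFiniteType k K] (M₁ M₂ : Literature.AlgebraicGeometry.Resolution.ProperModel k K), ∃ (N : Literature.AlgebraicGeometry.Resolution.ProperModel k K) (φ₁ : N.Hom M₁) (φ₂ : N.Hom M₂), φ₁.RegLe ∧ φ₂.RegLe) → Summit.ResolutionOfSingularities.ResolutionOfSingularities.Theses.CleanCovers.CoverResolution := by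
  intro hL hT p hp k _ _ _ n X f hint hfin hsurj het
  haveI := hfin
  haveI := hint
  haveI : IsProper (Literature.AlgebraicGeometry.Motives.projectiveSpace n k).hom :=
    Literature.AlgebraicGeometry.Motives.isProper_projectiveSpace n k
  -- the `k`-structure of `X`
  let g : X ⟶ Spec (.of k) := f ≫ (Literature.AlgebraicGeometry.Motives.projectiveSpace n k).hom
  haveI : IsSeparated g := inferInstance
  haveI : LocallyOfFiniteType g := inferInstance
  haveI : QuasiCompact g := inferInstance
  haveI : IsLocallyNoetherian X := LocallyOfFiniteType.isLocallyNoetherian g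
  haveI : CompactSpace X := QuasiCompact.compactSpace_of_compactSpace g
  refine stub_coverInductionOverField X inferInstance hint
    (stub_kedlayaLocalCover k n X f het (hL p hp k n X f hint hfin hsurj het)) ?_
  intro W hW U V hUV hU hV
  haveI := hW
  exact stub_binaryPatchingOverField k (hT p hp k) W (W.ι ≫ g)
    inferInstance inferInstance inferInstance hW U V hUV hU hV

/-! ## The crux implies both pieces -/

/-- **`CoverResolution → L`**: resolve the Kedlaya cover and restrict the resolution to the open
`f⁻¹(B)` with `B = ⊤` (`Scheme.HasResolution.restrict`). So L is a consequence of the crux, hence of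
the summit. [folklore] -/
theorem boundaryLocalResolution_of_coverResolution : Summit.ResolutionOfSingularities.ResolutionOfSingularities.Theses.CleanCovers.CoverResolution → (∀ p : ℕ, p.Prime → ∀ (k : Type) [Field k] [CharP k p] [PerfectField k] (n : ℕ) (X : AlgebraicGeometry.Scheme.{0}) (f : X ⟶ (Literature.AlgebraicGeometry.Motives.projectiveSpace n k).left), AlgebraicGeometry.IsIntegral X → AlgebraicGeometry.IsFinite f → Function.Surjective f.base → (letI := MvPolynomial.gradedAlgebra (σ := Fin (n + 1)) (R := k); AlgebraicGeometry.Etale (f ∣_ (AlgebraicGeometry.Proj.basicOpen (MvPolynomial.homogeneousSubmodule (Fin (n + 1)) k) (MvPolynomial.X (Fin.last n))))) → ∀ h : (Literature.AlgebraicGeometry.Motives.projectiveSpace n k).left, (letI := MvPolynomial.gradedAlgebra (σ := Fin (n + 1)) (R := k); h ∉ AlgebraicGeometry.Proj.basicOpen (MvPolynomial.homogeneousSubmodule (Fin (n + 1)) k) (MvPolynomial.X (Fin.last n))) → ∃ B : (Literature.AlgebraicGeometry.Motives.projectiveSpace n k).left.Opens, h ∈ B ∧ Literature.AlgebraicGeometry.Resolution.Scheme.HasResolution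 ((f ⁻¹ᵁ B : X.Opens) : AlgebraicGeometry.Scheme.{0})) := by
  intro hC p hp k _ _ _ n X f hint hfin hsurj het h _
  exact ⟨⊤, trivial, (hC p hp k n X f hint hfin hsurj het).restrict (f ⁻¹ᵁ ⊤)⟩

/-- **`CoverResolution → T`**: two-model patching of proper models over perfect fields of
characteristic `p` follows from the crux. By the proved crux `KedlayaReduction`
(`kedlayaReduction_proof`), `CoverResolution` at `p` resolves every reduced separated scheme of
finite type over every perfect field of characteristic `p`, in particular the (integral, proper)
join `M₁ ⋈ M₂` of two proper models of `K/k`; a regular proper model dominating the join is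
`RegLe` over `M₁` and over `M₂`. [cite: ZariskiSamuel1960, Ch. VI §17 (joins of models)] -/
theorem twoModelPatchingPerfect_of_coverResolution : Summit.ResolutionOfSingularities.ResolutionOfSingularities.Theses.CleanCovers.CoverResolution → (∀ p : ℕ, p.Prime → ∀ (k : Type) [Field k] [CharP k p] [PerfectField k] (K : Type) [Field K] [Algebra k K] [Algebra.EssFiniteType k K] (M₁ M₂ : Literature.AlgebraicGeometry.Resolution.ProperModel k K), ∃ (N : Literature.AlgebraicGeometry.Resolution.ProperModel k K) (φ₁ : N.Hom M₁) (φ₂ : N.Hom M₂), φ₁.RegLe ∧ φ₂.RegLe) := by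
  intro hC p hp k _ _ _ K _ _ _ M₁ M₂
  have hR := kedlayaReduction_proof p hp (hC p hp)
  obtain ⟨N, φ, hN⟩ := (ProperModel.join M₁ M₂).exists_hom_isRegular_of_hasResolution
    (hR k (ProperModel.join M₁ M₂).X (ProperModel.join M₁ M₂).π inferInstance inferInstance
      inferInstance inferInstance)
  exact ⟨N, φ.comp (ProperModel.joinFst M₁ M₂), φ.comp (ProperModel.joinSnd M₁ M₂),
    fun y _ => hN y, fun y _ => hN y⟩

/-! ## The v2 split is an equivalence -/

/-- **`CoverResolution ↔ L ∧ T`**: the crux is EQUIVALENT to the conjunction of the two open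
stubs of line `strategy-split` v2 — local resolution of Kedlaya covers along the hyperplane at
infinity, and Zariski's two-model patching of proper models over perfect fields. `→` by
restriction of a resolution and by resolving joins (`KedlayaReduction`); `←` is the assembly.
[folklore] -/
theorem coverResolution_iff_boundaryLocalResolution_and_twoModelPatchingPerfect : Summit.ResolutionOfSingularities.ResolutionOfSingularities.Theses.CleanCovers.CoverResolution ↔ ((∀ p : ℕ, p.Prime → ∀ (k : Type) [Field k] [CharP k p] [PerfectField k] (n : ℕ) (X : AlgebraicGeometry.Scheme.{0}) (f : X ⟶ (Literature.AlgebraicGeometry.Motives.projectiveSpace n k).left), AlgebraicGeometry.IsIntegral X → AlgebraicGeometry.IsFinite f → Function.Surjective f.base → (letI := MvPolynomial.gradedAlgebra (σ := Fin (n + 1)) (R := k); AlgebraicGeometry.Etale (f ∣_ (AlgebraicGeometry.Proj.basicOpen (MvPolynomial.homogeneousSubmodule (Fin (n + 1)) k) (MvPolynomial.X (Fin.last n))))) → ∀ h : (Literature.AlgebraicGeometry.Motives.projectiveSpace n k).left, (letI := MvPolynomial.gradedAlgebra (σ := Fin (n + 1)) (R := k); h ∉ AlgebraicGeometry.Proj.basicOpen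 (MvPolynomial.homogeneousSubmodule (Fin (n + 1)) k) (MvPolynomial.X (Fin.last n))) → ∃ B : (Literature.AlgebraicGeometry.Motives.projectiveSpace n k).left.Opens, h ∈ B ∧ Literature.AlgebraicGeometry.Resolution.Scheme.HasResolution ((f ⁻¹ᵁ B : X.Opens) : AlgebraicGeometry.Scheme.{0})) ∧ (∀ p : ℕ, p.Prime → ∀ (k : Type) [Field k] [CharP k p] [PerfectField k] (K : Type) [Field K] [Algebra k K] [Algebra.EssFiniteType k K] (M₁ M₂ : Literature.AlgebraicGeometry.Resolution.ProperModel k K), ∃ (N : Literature.AlgebraicGeometry.Resolution.ProperModel k K) (φ₁ : N.Hom M₁) (φ₂ : N.Hom M₂), φ₁.RegLe ∧ φ₂.RegLe)) :=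
  ⟨fun hC => ⟨boundaryLocalResolution_of_coverResolution hC, twoModelPatchingPerfect_of_coverResolution hC⟩,
    fun h => coverResolution_of_boundaryLocalResolution_of_twoModelPatchingPerfect h.1 h.2⟩

/-! ## v1 ⟹ v2 locally: log-regular models + Nizioł give local resolutions -/

/-- **P1 → P2 → L**: base-local proper birational LOG-REGULAR (fs étale charts) models along the
hyperplane at infinity (v1's `BoundaryLogRegularization`) together with resolution of quasi-compact
log-regular schemes (v1's `LogRegularResolution` = Nizioł 2006 Cor. 5.7, taken as a hypothesis)
give local RESOLUTIONS (v2's L): the model `Y → f⁻¹(B)` is proper over an open of the Noetherian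
`X`, hence quasi-compact, so P2 resolves `Y`, and resolutions descend along proper birational
morphisms (`Scheme.HasResolution.of_isBirational`). [cite: Niziol2006, Cor. 5.7] -/
theorem boundaryLocalResolution_of_boundaryLogRegularization_of_logRegularResolution : (∀ p : ℕ, p.Prime → ∀ (k : Type) [Field k] [CharP k p] [PerfectField k] (n : ℕ) (X : AlgebraicGeometry.Scheme.{0}) (f : X ⟶ (Literature.AlgebraicGeometry.Motives.projectiveSpace n k).left), AlgebraicGeometry.IsIntegral X → AlgebraicGeometry.IsFinite f → Function.Surjective f.base → (letI := MvPolynomial.gradedAlgebra (σ := Fin (n + 1)) (R := k); AlgebraicGeometry.Etale (f ∣_ (AlgebraicGeometry.Proj.basicOpen (MvPolynomial.homogeneousSubmodule (Fin (n + 1)) k) (MvPolynomial.X (Fin.last n))))) → ∀ h : (Literature.AlgebraicGeometry.Motives.projectiveSpace n k).left, (letI := MvPolynomial.gradedAlgebra (σ := Fin (n + 1)) (R := k); h ∉ AlgebraicGeometry.Proj.basicOpen (MvPolynomial.homogeneousSubmodule (Fin (n + 1)) k) (MvPolynomial.X (Fin.last n))) → ∃ B : (Literature.AlgebraicGeometry.Motives.projectiveSpace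 n k).left.Opens, h ∈ B ∧ ∃ (Y : AlgebraicGeometry.Scheme.{0}) (π : Y ⟶ ((f ⁻¹ᵁ B : X.Opens) : AlgebraicGeometry.Scheme.{0})), AlgebraicGeometry.IsProper π ∧ Literature.AlgebraicGeometry.Resolution.IsBirational π ∧ Literature.AlgebraicGeometry.Resolution.Scheme.IsLogRegularEtale Y) → (∀ (Y : AlgebraicGeometry.Scheme.{0}), CompactSpace Y → Literature.AlgebraicGeometry.Resolution.Scheme.IsLogRegularEtale Y → Literature.AlgebraicGeometry.Resolution.Scheme.HasResolution Y) → (∀ p : ℕ, p.Prime → ∀ (k : Type) [Field k] [CharP k p] [PerfectField k] (n : ℕ) (X : AlgebraicGeometry.Scheme.{0}) (f : X ⟶ (Literature.AlgebraicGeometry.Motives.projectiveSpace n k).left), AlgebraicGeometry.IsIntegral X → AlgebraicGeometry.IsFinite f → Function.Surjective f.base → (letI := MvPolynomial.gradedAlgebra (σ := Fin (n + 1)) (R := k); AlgebraicGeometry.Etale (f ∣_ (AlgebraicGeometry.Proj.basicOpen (MvPolynomial.homogeneousSubmodule (Fin (n + 1)) k) (MvPolynomial.X (Fin.last n))))) →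 ∀ h : (Literature.AlgebraicGeometry.Motives.projectiveSpace n k).left, (letI := MvPolynomial.gradedAlgebra (σ := Fin (n + 1)) (R := k); h ∉ AlgebraicGeometry.Proj.basicOpen (MvPolynomial.homogeneousSubmodule (Fin (n + 1)) k) (MvPolynomial.X (Fin.last n))) → ∃ B : (Literature.AlgebraicGeometry.Motives.projectiveSpace n k).left.Opens, h ∈ B ∧ Literature.AlgebraicGeometry.Resolution.Scheme.HasResolution ((f ⁻¹ᵁ B : X.Opens) : AlgebraicGeometry.Scheme.{0})) := by
  intro hP1 hP2 p hp k _ _ _ n X f hint hfin hsurj het h hh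
  obtain ⟨B, hhB, Y, π, hπ, hbir, hY⟩ := hP1 p hp k n X f hint hfin hsurj het h hh
  haveI := hfin
  haveI := hπ
  haveI : IsProper (Literature.AlgebraicGeometry.Motives.projectiveSpace n k).hom :=
    Literature.AlgebraicGeometry.Motives.isProper_projectiveSpace n k
  haveI : IsLocallyNoetherian (Literature.AlgebraicGeometry.Motives.projectiveSpace n k).left :=
    LocallyOfFiniteType.isLocallyNoetherian (Literature.AlgebraicGeometry.Motives.projectiveSpace n k).hom
  haveI : CompactSpace (Literature.AlgebraicGeometry.Motives.projectiveSpace n k).left :=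
    QuasiCompact.compactSpace_of_compactSpace (Literature.AlgebraicGeometry.Motives.projectiveSpace n k).hom
  haveI : IsLocallyNoetherian X := LocallyOfFiniteType.isLocallyNoetherian f
  haveI : CompactSpace X := QuasiCompact.compactSpace_of_compactSpace f
  haveI : IsNoetherian X := {}
  -- `f⁻¹(B)` is an open of the Noetherian `X`, hence quasi-compact, and so is `Y` (proper over it)
  haveI : CompactSpace ((f ⁻¹ᵁ B : X.Opens) : Scheme.{0}) :=
    QuasiCompact.compactSpace_of_compactSpace (f ⁻¹ᵁ B).ι
  haveI : CompactSpace Y := QuasiCompact.compactSpace_of_compactSpace π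
  exact ⟨B, hhB, Scheme.HasResolution.of_isBirational π hbir (hP2 Y inferInstance hY)⟩

/-! ## T is a slice of the catalogued open core of Zariski's programme -/

/-- **`(∀ p, ProperModel.TwoModelPatching p) → T`**: two-model patching over perfect fields is the
slice at perfect ground fields of the tree's catalogued statement `ProperModel.TwoModelPatching`
(Piltant 2013, Prop. 5.1 with `P = P_reg`; open in transcendence degree `≥ 4`), the atom shared
with the sibling cruxes `UniversalCells.LocalToGlobal` and `PatchingRelPerfect`.
[cite: Piltant2013, Prop. 5.1 and p. 2] -/
theorem twoModelPatchingPerfect_of_twoModelPatching : (∀ p : ℕ, p.Prime → Literature.AlgebraicGeometry.Resolution.ProperModel.TwoModelPatching.{0} p) → (∀ p : ℕ, p.Prime → ∀ (k : Type) [Field k] [CharP k p] [PerfectField k] (K : Type) [Field K] [Algebra k K] [Algebra.EssFiniteType k K] (M₁ M₂ : Literature.AlgebraicGeometry.Resolution.ProperModel k K), ∃ (N : Literature.AlgebraicGeometry.Resolution.ProperModel k K) (φ₁ : N.Hom M₁) (φ₂ : N.Hom M₂), φ₁.RegLe ∧ φ₂.RegLe) :=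
  fun hZ p hp k _ _ _ K _ _ _ M₁ M₂ => hZ p hp k K M₁ M₂

end Summit.ResolutionOfSingularities.ResolutionOfSingularities.Theorems

end
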